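import Summits.ABC.StewartYu.PadicG3TwoFrameSatData
import Summits.ABC.StewartYu.SatBasisReduced
import HarnessLib

/-!
# Cell abc-stewartyu, WP-L.P(2) (crux r4 `PadicCoreTwoRat`, stmt-ABC-20504), TOP ASSEMBLY v2: the Kummer-free frame from the reduced
# saturated basis kit WITH THE INDEX IDENTITY `N = |det C|`, and the record's supply that may use it

`Summits/ABC/StewartYu/PadicG3TwoFrameSatDet.lean` — cell `abc-stewartyu` (HOME `run/shared/lean/pub/abc-stewartyu/`), route
`YuMatveevShapeRat`, seat p3 (g10, WP-L.P(2) lead; design line STATUS 2026-08-27T18:43Z).  Two definitions and two theorems; no named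
fact.  v2 of `PadicG3TwoFrameSatData` (p3-g9): the landed interface `RecordSupplyTwoSat` hands the record the saturated presentation
`(ϑ, C, U, N)` with `U·C = C·U = N•1` but NOT the index identity `N = |det C| = [𝔑 : ℤ^{d+1}]`, although the kit
(`SatBasisReduced.exists_reduced_satFrame`, p1) proves it.  The record NEEDS it: its Siegel count runs over the full skew family
`𝔑 ∩ (virtual box N·s)`, whose size is `|det C|·∏ 2sⱼ` (`SatBox.card_satBox_ge`), and the `Y₀`-degree is divided by `N` (p1's ParN
design (N2), twin at `p = 2`) — the two match only when `N = |det C|`.  Hence: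

* **`SatKitFullDet n`** — `SatKitFull n` with the conjunct `(N : ℤ) = |det C|`; **`satKitFullDet_holds : ∀ n, SatKitFullDet n`**;
* **`RecordSupplyTwoSatDet C d`** — `RecordSupplyTwoSat C d` with the extra HYPOTHESIS `(N : ℤ) = |det C|` (a weaker demand on the
  record; any proof of `RecordSupplyTwoSat` gives it);
* **`frameTwoRat_of_recordSatDet`** — `SatKitFullDet (d+1) → RecordSupplyTwoSatDet C d → FrameTwoRat C (d+1)`: the landed proof of
  `frameTwoRat_of_recordSat` verbatim, threading `|det (C ∘ e)| = |det C|` through the pivot permutation (`Matrix.det_permute'`).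

WHAT THIS IS NOT: no record (`RecordSupplyTwoSatDet` is the open stub of line `padic-two-sat-frame` after its re-cut); no crux moves
(A1.L not moved).

References: Yu. V. Nesterenko, LNM 1819 (2003), §3.4 (`N = [𝔑 : ℤⁿ]`), §3.5, §4.3 Cor 4.5, §5; K. Yu, Acta Math. 211 (2013), §1.1
p.319, §6; HOME/p3/memo-11, memo-12.
-/

noncomputable section

open Finset Polynomial
open scoped Matrix Nat
open Literature.NumberTheory.Transcendental
open Literature.NumberTheory.Transcendental (FeldmanDelta.den)
open Literature.NumberTheory.Transcendental.CW77.Setup (Tau tauNorm)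

namespace Summit.ABC.StewartYu

/-! ### The reduced saturated basis kit with the index identity -/

/-- **The reduced saturated basis kit at rank `n`, with the index identity `N = |det C|`** (= `SatKitFull n` plus that conjunct).
[cite: Nesterenko2003, §3.4–§3.5 (p.105) and §4.3 Cor 4.5; shape only] -/
def SatKitFullDet (n : ℕ) : Prop :=
  ∀ a : Fin n → ℚ, (∀ j, 0 < a j) → (∀ μ : Fin n → ℤ, ∏ j, a j ^ μ j = 1 → μ = 0) →
    ∃ (θ : Fin n → ℚ) (U C : Matrix (Fin n) (Fin n) ℤ) (N : ℕ),
      (∀ i, 0 < θ i) ∧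
      (∀ μ : Fin n → ℤ, ∏ i, θ i ^ μ i = 1 → μ = 0) ∧
      (∀ q : ℕ, 0 < q → ∀ γ : ℚ, (∃ c : Fin n → ℤ, γ ^ q = ∏ i, θ i ^ c i) →
        ∃ c : Fin n → ℤ, γ = ∏ i, θ i ^ c i ∨ -γ = ∏ i, θ i ^ c i) ∧
      0 < N ∧ (∀ i, θ i ^ N = ∏ j, a j ^ U i j) ∧ (∀ j, a j = ∏ i, θ i ^ C j i) ∧
      U * C = (N : ℤ) • (1 : Matrix (Fin n) (Fin n) ℤ) ∧ C * U = (N : ℤ) • (1 : Matrix (Fin n) (Fin n) ℤ) ∧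
      (N : ℤ) = |C.det| ∧
      (N : ℝ) ≤ ∏ j, (2 * max 1 (Height.logHeight₁ (a j)) / Real.log 2) ∧
      (∀ j, ∑ i, |U i j| ≤ (n : ℤ) * N) ∧ (∀ j k, |C j k| ≤ ((n ! : ℕ) : ℤ) * N) ∧
      (∀ i, Height.logHeight₁ (θ i) ≤ ∑ j, max 1 (Height.logHeight₁ (a j)))

/-- **The kit with the index identity holds at every rank** (from p1's `SatBasisReduced.exists_reduced_satFrame`, which carries
`(N : ℤ) = |det C|`; the size lines weakened as in `satKitFull_holds`). [cite: Nesterenko2003, §3.5 and §4.3 Cor 4.5; shape only] -/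
theorem satKitFullDet_holds (n : ℕ) : SatKitFullDet n := by
  intro a ha hind
  obtain ⟨θ, U, C, N, hpos, hθind, hsat, _h2K, hN, hU, hC, hUC, hCU, hdet, hNle, _hU0, hUcol, hCbnd, hhθ, _hunit⟩ :=
    SatBasisReduced.exists_reduced_satFrame a ha hind
  refine ⟨θ, U, C, N, hpos, hθind, hsat, hN, hU, hC, hUC, hCU, hdet, ?_, hUcol, ?_, ?_⟩
  · refine hNle.trans (Finset.prod_le_prod (fun j _ => ?_) (fun j _ => ?_))
    · have : 0 ≤ Height.logHeight₁ (a j) := Height.zero_le_logHeight₁ _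
      have hl : 0 < Real.log 2 := Real.log_pos one_lt_two
      positivity
    · have hl : 0 < Real.log 2 := Real.log_pos one_lt_two
      exact div_le_div_of_nonneg_right (by linarith [le_max_right 1 (Height.logHeight₁ (a j))]) hl.le
  · intro j k
    refine (hCbnd j k).trans ?_
    have h1 : (((n - 1) ! : ℕ) : ℤ) ≤ ((n ! : ℕ) : ℤ) := by
      exact_mod_cast Nat.factorial_le (Nat.sub_le n 1)
    have hN0 : (0 : ℤ) ≤ N := by positivity
    calc (((n - 1) ! : ℕ) : ℤ) * N ≤ ((n ! : ℕ) : ℤ) * N := mul_le_mul_of_nonneg_right h1 hN0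
      _ = ((n ! : ℕ) : ℤ) * N := rfl
  · intro i
    exact (hhθ i).trans (Finset.sum_le_sum fun j _ => le_max_right _ _)

/-- `SatKitFullDet n → SatKitFull n` (drop the index identity). [folklore] -/
theorem satKitFull_of_det {n : ℕ} (h : SatKitFullDet n) : SatKitFull n := by
  intro a ha hind
  obtain ⟨θ, U, C, N, hpos, hθind, hsat, hN, hU, hC, hUC, hCU, _hdet, hNle, hUcol, hCbnd, hhθ⟩ := h a ha hind
  exact ⟨θ, U, C, N, hpos, hθind, hsat, hN, hU, hC, hUC, hCU, hNle, hUcol, hCbnd, hhθ⟩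

namespace TwoSetup

open Summit.ABC.StewartYu.G3Boxes

/-! ### The record's supply, index identity available -/

/-- **THE RECORD'S SUPPLY FOR THE 𝔑-THREADED `2`-ADIC FRAME at rank `d + 1`, WITH THE INDEX IDENTITY**: the text of
`RecordSupplyTwoSat C d` with the additional hypothesis `(N : ℤ) = |det C|` on the pivot-last saturated presentation (so the record
may count the skew family `𝔑 ∩ N·box` by `SatBox.card_satBox_ge` and divide the `Y₀`-degree by `N`).
[cite: Yu2013, §3.1, §6; Nesterenko2003, §3.4–§3.5, §5.2 (5.14)–(5.22); shape only] -/
def RecordSupplyTwoSatDet (C : ℕ → ℝ) (d : ℕ) : Prop :=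
  ∀ (α : Fin (d + 1) → ℚ) (b : Fin (d + 1) → ℤ) (V : Fin (d + 1) → ℝ) (Vmax W : ℝ),
    (∀ j, 3 ≤ padicValRat 2 (α j - 1)) →
    (∀ μ : Fin (d + 1) → ℤ, ∏ j, α j ^ μ j = 1 → μ = 0) →
    (∀ j, Height.logHeight₁ (α j) ≤ V j) → (∀ j, 1 ≤ V j) → (∀ j, V j ≤ Vmax) →
    b ≠ 0 → (∀ j, Real.log (max 3 (|b j| : ℝ)) ≤ W) → 1 ≤ W →
    ¬ (padicValRat 2 (∏ j, α j ^ b j - 1) : ℝ) ≤ C (d + 1) * (∏ j, V j) * (W + Real.log (2 * Vmax)) →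
    ∀ (ϑ : Fin (d + 1) → ℚ) (Cm U : Matrix (Fin (d + 1)) (Fin (d + 1)) ℤ) (N : ℕ) (Ucol : Fin (d + 1) → ℕ)
      (hϑ : ∀ k, 3 ≤ padicValRat 2 (ϑ k - 1))
      (hlast : (b ᵥ* Cm) (Fin.last d) ≠ 0)
      (hmin : ∀ k, (b ᵥ* Cm) k ≠ 0 → padicValInt 2 ((b ᵥ* Cm) (Fin.last d)) ≤ padicValInt 2 ((b ᵥ* Cm) k))
      (hpos : ∀ k, 0 < ϑ k) (hN : 0 < N) (hU : ∀ k, ϑ k ^ N = ∏ j, (α j ^ 2) ^ U k j)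
      (hα2 : ∀ j, (0 : ℚ) < α j ^ 2),
      (∀ μ : Fin (d + 1) → ℤ, ∏ k, ϑ k ^ μ k = 1 → μ = 0) →
      (∀ j, α j ^ 2 = ∏ k, ϑ k ^ Cm j k) →
      U * Cm = (N : ℤ) • (1 : Matrix (Fin (d + 1)) (Fin (d + 1)) ℤ) →
      Cm * U = (N : ℤ) • (1 : Matrix (Fin (d + 1)) (Fin (d + 1)) ℤ) →
      (N : ℤ) = |Cm.det| →
      (N : ℝ) ≤ ∏ j, (2 * max 1 (Height.logHeight₁ (α j)) / Real.log 2) →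
      (∀ j, ∑ k, |U k j| ≤ (Ucol j : ℤ)) → (∀ j, (Ucol j : ℤ) ≤ (d + 1 : ℕ) * N) →
      (∀ j k, |Cm j k| ≤ (((d + 1) ! : ℕ) : ℤ) * N) →
      (∀ k, Height.logHeight₁ (ϑ k) ≤ 2 * ∑ j, max 1 (Height.logHeight₁ (α j))) →
      ∃ (σ : (ofData d ϑ (b ᵥ* Cm) hϑ hlast hmin).G3TwoSched) (Bv : ℕ → Fin (d + 1) → ℕ)
        (Bv₀ : Fin (d + 1) → ℕ) (H L₀ : ℕ) (B : Finset (ℕ × ((Fin d → ℤ) × ℤ))) (S₀ X D₀' : ℕ)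
        (D' : Fin (d + 1) → ℕ),
        FrameNumericsTwoRASat σ
          (satDataOf d ϑ (b ᵥ* Cm) hϑ hlast hmin (fun j => α j ^ 2) hα2 hpos U N hN hU) Bv Bv₀ Ucol H L₀ B ∧
        ‖(ofData d ϑ (b ᵥ* Cm) hϑ hlast hmin).Λ₀‖ ≤ ((2 : ℝ) ^ (σ.m + 3))⁻¹ ∧
        (d + 1 + 1) * X ≤ σ.Nfin σ.Istar ∧ (d + 1 + 1) * S₀ < σ.Tfin σ.Istar ∧
        σ.D₀ ≤ D₀' ∧ (∀ j, Bv σ.Istar j ≤ D' j) ∧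
        GenThreeFrameSpecTwo.RecordTwo C (d + 1) V Vmax W D₀' S₀ X D'

/-- Any proof of the landed `RecordSupplyTwoSat` gives `RecordSupplyTwoSatDet` (the extra hypothesis is ignored). [folklore] -/
theorem recordSupplyTwoSatDet_of {C : ℕ → ℝ} {d : ℕ} (h : RecordSupplyTwoSat C d) : RecordSupplyTwoSatDet C d := by
  intro α b V Vmax W hα hind hV hV1 hVmax hb hW hW1 hneg ϑ Cm U N Ucol hϑ hlast hmin hpos hN hU hα2 hϑind hαo hUC hCU _hdet
    hNle hUcol1 hUcol2 hCbnd hhϑ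
  exact h α b V Vmax W hα hind hV hV1 hVmax hb hW hW1 hneg ϑ Cm U N Ucol hϑ hlast hmin hpos hN hU hα2 hϑind hαo hUC hCU
    hNle hUcol1 hUcol2 hCbnd hhϑ

/-! ### The frame from the kit and the record (index identity threaded) -/

/-- **THE KUMMER-FREE `2`-ADIC FRAME at rank `d + 1` from the reduced saturated basis kit WITH `N = |det C|` and the record's supply
that may use it** (the landed `frameTwoRat_of_recordSat`, with `|det (C ∘ e)| = |det C|` through the pivot permutation).
[cite: Yu2007, Main Thm (K = ℚ, ℘ = 2); shape only] [cite: Nesterenko2003, §4.3, §5] -/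
theorem frameTwoRat_of_recordSatDet {C : ℕ → ℝ} {d : ℕ} (hkit : SatKitFullDet (d + 1))
    (hrec : RecordSupplyTwoSatDet C d) :
    GenThreeFrameSpecTwoRat.FrameTwoRat C (d + 1) := by
  classical
  intro α b V Vmax W hα hind hV hV1 hVmax hb hW hW1 hneg
  haveI : Fact (Nat.Prime 2) := ⟨Nat.prime_two⟩
  have hα0 : ∀ j, α j ≠ 0 := fun j => ne_zero_of_three_le (hα j)
  have hαv : ∀ j, padicValRat 2 (α j) = 0 := fun j => GenThreeInductionTwo.padicValRat_eq_zero_of_three_le (hα j)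
  -- the kit on `|α|`
  have habs : ∀ j, 0 < |α j| := fun j => abs_pos.mpr (hα0 j)
  obtain ⟨θ, U, Cm, N, hθpos, hθind, hsat, hNpos, hUθ, hCθ, hUC, hCU, hdet, hNle, hUcol, hCbnd, hhθ⟩ :=
    hkit (fun j => |α j|) habs (SatFrameKit.mulIndep_abs α hind)
  have hθ0 : ∀ i, θ i ≠ 0 := fun i => (hθpos i).ne'
  -- `ϑ := θ²`
  set ϑ : Fin (d + 1) → ℚ := fun i => θ i ^ 2 with hϑdef
  have hϑpos : ∀ i, 0 < ϑ i := fun i => pow_pos (hθpos i) 2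
  have hαv' : ∀ j, padicValRat 2 (|α j|) = 0 := by
    intro j; rcases abs_choice (α j) with h | h
    · rw [h]; exact hαv j
    · rw [h, padicValRat.neg]; exact hαv j
  have hθv : ∀ i, padicValRat 2 (θ i) = 0 := by
    intro i
    have h1 : padicValRat 2 (θ i ^ N) = 0 := by
      rw [hUθ i]; exact SatFrameKit.padicValRat_prod_zpow_eq_zero _ (fun j => (habs j).ne') hαv' _
    exact SatFrameKit.padicValRat_eq_zero_of_pow hNpos.ne' h1
  have hϑ8 : ∀ i, 3 ≤ padicValRat 2 (ϑ i - 1) := by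
    intro i
    have h1 : θ i ^ 2 - 1 ≠ 0 := by
      intro h0
      have hsq : θ i ^ 2 = 1 := sub_eq_zero.mp h0
      have hone : ∏ k, θ k ^ (Pi.single i 2 : Fin (d + 1) → ℤ) k = 1 := by
        rw [Finset.prod_eq_single i (fun k _ hk => by rw [Pi.single_eq_of_ne hk, zpow_zero])
          (fun h => absurd (Finset.mem_univ i) h), Pi.single_eq_same]
        exact_mod_cast hsq
      have := congr_fun (hθind _ hone) i
      simp at this
    exact Literature.NumberTheory.EllipticCurves.Wiles2000.three_le_padicValRat_sq_sub_one (hθ0 i) (hθv i) h1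
  have hϑind : ∀ μ : Fin (d + 1) → ℤ, ∏ i, ϑ i ^ μ i = 1 → μ = 0 := by
    intro μ hμ
    have h2 : ∏ i, θ i ^ (2 * μ i) = 1 := by
      calc ∏ i, θ i ^ (2 * μ i) = ∏ i, (θ i ^ 2) ^ μ i := prod_congr rfl fun i _ => by rw [zpow_mul]; norm_cast
        _ = 1 := hμ
    have := hθind _ h2
    funext i
    have hi := congr_fun this i
    simp only [Pi.zero_apply, mul_eq_zero, OfNat.ofNat_ne_zero, false_or] at hi
    exact hi
  have hsat3 : ∀ γ : ℚ, (∃ c : Fin (d + 1) → ℤ, γ ^ 3 = ∏ i, θ i ^ c i) → ∃ c : Fin (d + 1) → ℤ, γ = ∏ i, θ i ^ c i := by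
    rintro γ ⟨c, hc⟩
    obtain ⟨c', hc' | hc'⟩ := hsat 3 (by norm_num) γ ⟨c, hc⟩
    · exact ⟨c', hc'⟩
    · exfalso
      have hγpos : 0 < γ := by
        have h3 : 0 < γ ^ 3 := by rw [hc]; exact prod_pos fun i _ => zpow_pos (hθpos i) _
        exact (Odd.pow_pos_iff (by decide : Odd 3)).mp h3
      have : 0 < -γ := by rw [hc']; exact prod_pos fun i _ => zpow_pos (hθpos i) _
      linarith
  have hϑK3 : ∀ (κ : Fin (d + 1) → ℤ) (γ : ℚ), ∏ i, ϑ i ^ κ i = γ ^ 3 → ∀ i, (3 : ℤ) ∣ κ i := by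
    intro κ γ h i
    have h2 : ∏ k, θ k ^ (2 * κ k) = γ ^ 3 := by
      calc ∏ k, θ k ^ (2 * κ k) = ∏ k, (θ k ^ 2) ^ κ k := prod_congr rfl fun k _ => by rw [zpow_mul]; norm_cast
        _ = γ ^ 3 := h
    have h3 := Literature.NumberTheory.DiophantineGeometry.KummerSaturated.three_dvd_of_prod_zpow_eq_cube_rat
      hθ0 hθind hsat3 h2 i
    have h32 : IsCoprime (3 : ℤ) 2 := by norm_num [Int.isCoprime_iff_gcd_eq_one]
    exact h32.dvd_of_dvd_mul_left h3
  have hαo : ∀ j, α j ^ 2 = ∏ i, ϑ i ^ Cm j i := by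
    intro j
    rw [SatFrameKit.prod_sq_zpow, ← hCθ j, sq_abs]
  have hUϑ : ∀ i, ϑ i ^ N = ∏ j, (α j ^ 2) ^ U i j := by
    intro i
    calc ϑ i ^ N = (θ i ^ N) ^ 2 := by show (θ i ^ 2) ^ N = _; ring
      _ = (∏ j, |α j| ^ U i j) ^ 2 := by rw [hUθ i]
      _ = ∏ j, (|α j| ^ 2) ^ U i j := (SatFrameKit.prod_sq_zpow _ _).symm
      _ = ∏ j, (α j ^ 2) ^ U i j := prod_congr rfl fun j _ => by rw [sq_abs]
  have hhϑ : ∀ i, Height.logHeight₁ (ϑ i) ≤ 2 * ∑ j, max 1 (Height.logHeight₁ (α j)) := by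
    intro i
    rw [hϑdef]; dsimp only
    rw [Height.logHeight₁_pow]
    have := hhθ i
    have e : ∀ j, Height.logHeight₁ (|α j|) = Height.logHeight₁ (α j) := by
      intro j; rcases abs_choice (α j) with h | h
      · rw [h]
      · rw [h, Height.logHeight₁_neg]
    simp only [e] at this
    push_cast; linarith
  have hNle' : (N : ℝ) ≤ ∏ j, (2 * max 1 (Height.logHeight₁ (α j)) / Real.log 2) := by
    refine hNle.trans (le_of_eq (prod_congr rfl fun j _ => ?_))
    rcases abs_choice (α j) with h | h
    · rw [h]
    · rw [h, Height.logHeight₁_neg]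
  -- `det C ≠ 0`, `b̃ := b ᵥ* C ≠ 0`
  have hNz : ((N : ℤ)) ≠ 0 := by exact_mod_cast hNpos.ne'
  have hdetC : Cm.det ≠ 0 := by
    intro h0
    have := congrArg Matrix.det hUC
    rw [Matrix.det_mul, h0, mul_zero, Matrix.det_smul, Matrix.det_one, mul_one, Fintype.card_fin] at this
    exact pow_ne_zero _ hNz this.symm
  have hbt : b ᵥ* Cm ≠ 0 := SatFrameKit.vecMul_ne_zero_of_det_ne_zero Cm hdetC hb
  -- the pivot: a coordinate of `b̃` of minimal `2`-adic order, swapped to the last place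
  have hne : (Finset.univ.filter fun k => (b ᵥ* Cm) k ≠ 0).Nonempty := by
    by_contra h0
    rw [Finset.not_nonempty_iff_eq_empty, Finset.filter_eq_empty_iff] at h0
    apply hbt; funext k
    have := h0 (Finset.mem_univ k)
    push Not at this
    exact this
  obtain ⟨k₀, hk₀mem, hk₀min⟩ :=
    Finset.exists_min_image (Finset.univ.filter fun k => (b ᵥ* Cm) k ≠ 0) (fun k => padicValInt 2 ((b ᵥ* Cm) k)) hne
  have hbk₀ : (b ᵥ* Cm) k₀ ≠ 0 := (Finset.mem_filter.mp hk₀mem).2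
  set e : Equiv.Perm (Fin (d + 1)) := Equiv.swap (Fin.last d) k₀ with he
  have helast : e (Fin.last d) = k₀ := by rw [he, Equiv.swap_apply_left]
  -- the permuted presentation
  set ϑ' : Fin (d + 1) → ℚ := fun k => ϑ (e k) with hϑ'
  set C' : Matrix (Fin (d + 1)) (Fin (d + 1)) ℤ := Matrix.of fun j k => Cm j (e k) with hC'
  set U' : Matrix (Fin (d + 1)) (Fin (d + 1)) ℤ := Matrix.of fun k j => U (e k) j with hU'
  have hbC' : ∀ k, (b ᵥ* C') k = (b ᵥ* Cm) (e k) := fun k => by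
    simp only [hC', Matrix.vecMul, dotProduct, Matrix.of_apply]
  have hlast : (b ᵥ* C') (Fin.last d) ≠ 0 := by rw [hbC', helast]; exact hbk₀
  have hmin' : ∀ k, (b ᵥ* C') k ≠ 0 → padicValInt 2 ((b ᵥ* C') (Fin.last d)) ≤ padicValInt 2 ((b ᵥ* C') k) := by
    intro k hk
    rw [hbC', helast]; rw [hbC'] at hk
    exact hk₀min (e k) (Finset.mem_filter.mpr ⟨Finset.mem_univ _, hk⟩)
  have hϑ'8 : ∀ k, 3 ≤ padicValRat 2 (ϑ' k - 1) := fun k => hϑ8 (e k)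
  have hϑ'pos : ∀ k, 0 < ϑ' k := fun k => hϑpos (e k)
  have hU'ϑ : ∀ k, ϑ' k ^ N = ∏ j, (α j ^ 2) ^ U' k j := fun k => hUϑ (e k)
  have hα2 : ∀ j, (0 : ℚ) < α j ^ 2 := fun j => by have := hα0 j; positivity
  have hϑ'ind : ∀ μ : Fin (d + 1) → ℤ, ∏ k, ϑ' k ^ μ k = 1 → μ = 0 := by
    intro μ hμ
    have h1 : ∏ i, ϑ i ^ (μ ∘ e.symm) i = 1 := by
      rw [← Equiv.prod_comp e (fun i => ϑ i ^ (μ ∘ e.symm) i)]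
      simpa [Function.comp, Equiv.symm_apply_apply] using hμ
    have h0 := hϑind _ h1
    funext k
    have := congrFun h0 (e k)
    simpa [Function.comp, Equiv.symm_apply_apply] using this
  have hαo' : ∀ j, α j ^ 2 = ∏ k, ϑ' k ^ C' j k := by
    intro j; rw [hαo j]; exact (Equiv.prod_comp e (fun i => ϑ i ^ Cm j i)).symm
  have hU'C' : U' * C' = (N : ℤ) • (1 : Matrix (Fin (d + 1)) (Fin (d + 1)) ℤ) := by
    rw [hU', hC']
    ext k k'
    rw [submatrix_mul_submatrix_apply U Cm e k k', hUC]
    simp only [Matrix.smul_apply, Matrix.one_apply, smul_eq_mul, e.injective.eq_iff]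
  have hC'U' : C' * U' = (N : ℤ) • (1 : Matrix (Fin (d + 1)) (Fin (d + 1)) ℤ) := by
    rw [hU', hC']
    ext j l
    rw [submatrix_mul_submatrix_apply' U Cm e j l, hCU]
  have hdet' : (N : ℤ) = |C'.det| := by
    have hsub : C' = Cm.submatrix id ⇑e := rfl
    rw [hsub, Matrix.det_permute', abs_mul]
    rcases Int.units_eq_one_or (Equiv.Perm.sign e) with h | h <;> rw [h] <;> simpa using hdet
  have hU'col : ∀ j, ∑ k, |U' k j| ≤ ((d + 1 : ℕ) : ℤ) * N := by
    intro j
    have := hUcol j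
    rw [← Equiv.sum_comp e (fun i => |U i j|)] at this
    simpa only [hU', Matrix.of_apply] using this
  have hC'bnd : ∀ j k, |C' j k| ≤ (((d + 1) ! : ℕ) : ℤ) * N := fun j k => by
    simp only [hC', Matrix.of_apply]; exact hCbnd j (e k)
  have hhϑ' : ∀ k, Height.logHeight₁ (ϑ' k) ≤ 2 * ∑ j, max 1 (Height.logHeight₁ (α j)) := fun k => hhϑ (e k)
  -- the record's supply
  set Ucol : Fin (d + 1) → ℕ := fun j => (d + 1) * N with hUcoldef
  have hUcol1 : ∀ j, ∑ k, |U' k j| ≤ (Ucol j : ℤ) := fun j => by rw [hUcoldef]; push_cast; exact hU'col j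
  have hUcol2 : ∀ j, (Ucol j : ℤ) ≤ (d + 1 : ℕ) * N := fun j => by rw [hUcoldef]; push_cast; exact le_rfl
  obtain ⟨σ, Bv, Bv₀, H, L₀, B, S₀, X, D₀', D', hnum, hΛ, hX, hT, hD₀, hD, hrecord⟩ :=
    hrec α b V Vmax W hα hind hV hV1 hVmax hb hW hW1 hneg ϑ' C' U' N Ucol hϑ'8 hlast hmin' hϑ'pos hNpos hU'ϑ hα2
      hϑ'ind hαo' hU'C' hC'U' hdet' hNle' hUcol1 hUcol2 hC'bnd hhϑ'
  -- the set-up's saturation datum and the END hypotheses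
  have hdetU' : (satDataOf d ϑ' (b ᵥ* C') hϑ'8 hlast hmin' (fun j => α j ^ 2) hα2 hϑ'pos U' N hNpos hU'ϑ).U.det ≠ 0 := by
    intro h0
    have := congrArg Matrix.det hU'C'
    rw [Matrix.det_mul, Matrix.det_smul, Matrix.det_one, mul_one, Fintype.card_fin] at this
    change U'.det = 0 at h0
    rw [h0, zero_mul] at this
    exact pow_ne_zero _ hNz this.symm
  have hbU' : (b ᵥ* C') ᵥ* U' = (N : ℤ) • b := by
    rw [Matrix.vecMul_vecMul, hC'U', Matrix.vecMul_smul, Matrix.vecMul_one]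
  have hbU : (ofData d ϑ' (b ᵥ* C') hϑ'8 hlast hmin').ball ᵥ*
      (satDataOf d ϑ' (b ᵥ* C') hϑ'8 hlast hmin' (fun j => α j ^ 2) hα2 hϑ'pos U' N hNpos hU'ϑ).U =
      ((satDataOf d ϑ' (b ᵥ* C') hϑ'8 hlast hmin' (fun j => α j ^ 2) hα2 hϑ'pos U' N hNpos hU'ϑ).N : ℤ) • b := by
    have hball : (ofData d ϑ' (b ᵥ* C') hϑ'8 hlast hmin').ball = b ᵥ* C' :=
      ofData_ball ϑ' (b ᵥ* C') hϑ'8 hlast hmin'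
    rw [hball]
    exact hbU'
  have hK : ∀ κ : Fin ((ofData d ϑ' (b ᵥ* C') hϑ'8 hlast hmin').d + 1) → ℕ, (∃ j, ¬ 3 ∣ κ j) → ∀ γ : ℚ,
      ∏ j, (ofData d ϑ' (b ᵥ* C') hϑ'8 hlast hmin').toQ.all j ^ κ j ≠ γ ^ 3 := by
    change ∀ κ : Fin (d + 1) → ℕ, (∃ j, ¬ 3 ∣ κ j) → ∀ γ : ℚ,
      ∏ j, (ofData d ϑ' (b ᵥ* C') hϑ'8 hlast hmin').toQ.all j ^ κ j ≠ γ ^ 3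
    rw [ofData_all]
    refine KummerBasisChange.kummerNat_of_kummerInt 3 ϑ' fun ψ hψ k => ?_
    obtain ⟨γ, hγ⟩ := hψ
    have h1 : ∏ i, ϑ i ^ (ψ ∘ e.symm) i = γ ^ 3 := by
      rw [← Equiv.prod_comp e (fun i => ϑ i ^ (ψ ∘ e.symm) i)]
      simpa [Function.comp, Equiv.symm_apply_apply] using hγ
    have := hϑK3 _ γ h1 (e k)
    simpa [Function.comp, Equiv.symm_apply_apply] using this
  -- a pivot for the END
  obtain ⟨j₀, hbj₀⟩ : ∃ j₀, b j₀ ≠ 0 := by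
    by_contra h0
    push Not at h0
    exact hb (funext h0)
  have hout := frameOutputReal_of_numericsRASat σ _ Bv Bv₀ Ucol hnum hΛ hK b hbU hdetU' j₀ hX hT hD₀ hD
  -- independence of `ξⱼ = (αⱼ²)^{1/N}`
  have hα2ind : ∀ μ : Fin (d + 1) → ℤ, ∏ j, (α j ^ 2) ^ μ j = 1 → μ = 0 := by
    intro μ hμ
    have h2 : ∏ j, α j ^ (2 * μ j) = 1 := by
      calc ∏ j, α j ^ (2 * μ j) = ∏ j, (α j ^ 2) ^ μ j := prod_congr rfl fun j _ => by rw [zpow_mul]; norm_cast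
        _ = 1 := hμ
    have := hind _ h2
    funext j
    have hj := congr_fun this j
    simp only [Pi.zero_apply, mul_eq_zero, OfNat.ofNat_ne_zero, false_or] at hj
    exact hj
  have hNinv : ((N : ℝ))⁻¹ ≠ 0 := inv_ne_zero (by exact_mod_cast hNpos.ne')
  have hindξ := GenThreeEndReal.hind_units_of_rpow_rat (fun j => α j ^ 2) hα2 hα2ind hNinv
  refine ⟨_, j₀, D₀', S₀, X, D', fun ψ hψ => hindξ ψ ?_, hbj₀, hout, hrecord⟩
  convert hψ using 2 with j _
  rfl


end TwoSetup

end Summit.ABC.StewartYu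

end
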